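import Mathlib
import HarnessLib
import Literature.MathematicalPhysics.QuantumLattice.DWaveOrderParameterProofs
import Literature.MathematicalPhysics.QuantumLattice.GroundStateSourceBounds

/-!
# Crux `CwChiralConstruction` (stmt-HubbardSuperconductivity-1740), line `susceptibility-rise-budget`:
# the diagonal transfer `(h, h) ⟶ dWaveOrderParameter`

Support file (`--supports stmt-HubbardSuperconductivity-1740`, registered frame stub `stub_diagonalTransfer` of the
line `susceptibility-rise-budget`; the crux-plan's name). If, for a Hermitian co-source family `Y_L` with
`‖Y_L‖ ≤ b_Y (L+1)²`, the `d`-wave pair density of the tracial ground state of the DOUBLY-sourced torus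
`dWaveSourceTorus (L+1) U μ h - h·Y_L` (equal strengths: the diagonal of the two-source corner) is eventually-in-`L`
at least `ε` for all small `h > 0`, then `ε ≤ dWaveOrderParameter U μ` (the Koma–Tasaki order parameter with the
B₁g source ALONE). Proof: against the stair `h` of the one-source staircase use the diagonal point `(h', h')` with
`h' = o(h)`: its ground state is a trial state for the stair Hamiltonian, and the co-source never lowers `E₀(K)` by more
than `h'‖Y_L‖` beyond what the pair source does (`Re ω_K(Δ_d) = 0` by `U(1)`), so the linear energy GAIN of the stair
dominates `2h·(floor) - O(h')` per site (`cw_diagonal_fin`); then the tree lever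
`le_dWaveOrderParameter_of_le_liminf_energyGain`. Folklore convexity (Koma–Tasaki 1994 §1); no definitions.
-/

set_option linter.dupNamespace false

namespace Summit.HubbardSuperconductivity.HubbardSuperconductivity.Theorems

open Literature.MathematicalPhysics.QuantumLattice Literature.Probability.LatticeModels Matrix Filter
open scoped Matrix.Norms.L2Operator ComplexOrder Topology

/-! ### Frame, part 1: the diagonal transfer `(h', h') ⟶ dWaveOrderParameter` -/

/-- **Diagonal domination, finite volume.** For the grand-canonical torus `K = hubbardTorusWith 2 L 1 U μ`,
the pair operator `O = Δ_d + Δ_d†`, ANY Hermitian co-source `Yv`, `h' ≥ 0` and real `h`: the ground state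
of the doubly-sourced `K - h'O - h'Yv` is a trial state for the stair Hamiltonian `K - hO`, and the
co-source never lowers `E₀(K)` by more than `h'‖Yv‖` beyond what `O` does (`Re ω_K(O) = 0` by `U(1)`), so
`2h · Re ω_{K-h'O-h'Yv}(Δ_d) - 2h'(B_d L² + ‖Yv‖) ≤ E₀(K) - E₀(K - hO)`. [folklore convexity] -/
theorem cw_diagonal_fin (L : ℕ) [NeZero L] (U μ h : ℝ) {h' : ℝ} (hh' : 0 ≤ h')
    (Yv : Matrix (Finset (Orb (FermionTorus 2 L))) (Finset (Orb (FermionTorus 2 L))) ℂ)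
    (hYv : Yv.IsHermitian) :
    2 * h * ((dWaveSourceTorus L U μ h' - (h' : ℂ) • Yv).groundStateFunctional
        (pairField dWaveFormFactor L)).re -
      2 * h' * ((2 * ∑ e ∈ insert (0 : Site 2) unitSteps, |dWaveFormFactor e / Real.sqrt 2|) * (L : ℝ) ^ 2
        + ‖Yv‖) ≤
      (dWaveSourceTorus L U μ 0).groundEnergy - (dWaveSourceTorus L U μ h).groundEnergy := by
  set Bd : ℝ := 2 * ∑ e ∈ insert (0 : Site 2) unitSteps, |dWaveFormFactor e / Real.sqrt 2| with hBd
  set K := hubbardTorusWith 2 L 1 U μ with hKdef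
  set P := pairField dWaveFormFactor L with hPdef
  set O := P + Pᴴ with hOdef
  have hK : K.IsHermitian := isHermitian_hubbardTorusWith L 1 U μ
  have hO : O.IsHermitian := isHermitian_pairField_add_conjTranspose L
  have hsa : ∀ r : ℝ, IsSelfAdjoint (r : ℂ) := fun r => by
    rw [isSelfAdjoint_iff, Complex.star_def, Complex.conj_ofReal]
  have hOY : (O + Yv).IsHermitian := hO.add hYv
  -- the doubly-sourced Hamiltonian `A = K - h'(O + Yv)`
  set A := K - (h' : ℂ) • (O + Yv) with hAdef
  have hA : A.IsHermitian := isHermitian_sub_real_smul hK hOY h'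
  have hAeq : dWaveSourceTorus L U μ h' - (h' : ℂ) • Yv = A := by
    rw [hAdef, hOdef, hPdef, hKdef, dWaveSourceTorus_eq]
    simp only [smul_add]
    abel
  have hsrc0 : dWaveSourceTorus L U μ 0 = K := dWaveSourceTorus_zero L U μ
  have hsrch : dWaveSourceTorus L U μ h = K - (h : ℂ) • O := dWaveSourceTorus_eq L U μ h
  -- (1) trial state: `E₀(K - hO) ≤ E₀(A) + h' Re ω_A(O + Yv) - h Re ω_A(O)`
  have hB : (K - (h : ℂ) • O).IsHermitian := isHermitian_sub_real_smul hK hO h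
  have h1 := Matrix.groundEnergy_le_groundStateFunctional_re hA hB
  have hdec : K - (h : ℂ) • O = A + (h' : ℂ) • (O + Yv) - (h : ℂ) • O := by
    rw [hAdef]; abel
  rw [hdec, map_sub, map_add, map_smul, map_smul, Matrix.groundStateFunctional_hamiltonian hA] at h1
  simp only [Complex.sub_re, Complex.add_re, Complex.ofReal_re, smul_eq_mul,
    Complex.re_ofReal_mul] at h1
  -- (2) the co-source lowers `E₀(K)` by at most `h'‖Yv‖` beyond `O`: `E₀(A) ≤ E₀(K) + h'‖Yv‖`
  have h2 : A.groundEnergy ≤ K.groundEnergy + h' * ‖Yv‖ := by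
    have key := sub_mul_re_groundStateFunctional_le hK hOY 0 h'
    simp only [Complex.ofReal_zero, zero_smul, sub_zero] at key
    have hP0 : K.groundStateFunctional P = 0 :=
      groundStateFunctional_hubbardTorusWith_pairField (g := dWaveFormFactor) (L := L) 1 U μ
    have hO0 : (K.groundStateFunctional O).re = 0 := by
      rw [hOdef, map_add, Complex.add_re, groundStateFunctional_conjTranspose_re, hP0]
      simp
    have hY0 : -‖Yv‖ ≤ (K.groundStateFunctional Yv).re :=
      (abs_le.1 (abs_re_groundStateFunctional_le_norm hK Yv)).1
    have hsum : (K.groundStateFunctional (O + Yv)).re = (K.groundStateFunctional Yv).re := by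
      rw [map_add, Complex.add_re, hO0, zero_add]
    rw [hsum] at key
    rw [← hAdef] at key
    nlinarith [key, hY0, hh']
  -- (3) a priori bounds on the one-point functions in the state `ω_A`
  have hL := cast_sq_pos_of_neZero L
  have hPbd : |(A.groundStateFunctional P).re| ≤ Bd * (L : ℝ) ^ 2 :=
    (abs_re_groundStateFunctional_le_norm hA P).trans (norm_pairField_le dWaveFormFactor L)
  have hObd : (A.groundStateFunctional O).re ≤ 2 * (Bd * (L : ℝ) ^ 2) := by
    rw [hOdef, map_add, Complex.add_re, groundStateFunctional_conjTranspose_re]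
    have := (abs_le.1 hPbd).2
    linarith
  have hYbd : (A.groundStateFunctional Yv).re ≤ ‖Yv‖ :=
    (le_abs_self _).trans (abs_re_groundStateFunctional_le_norm hA Yv)
  have hOYre : (A.groundStateFunctional (O + Yv)).re =
      (A.groundStateFunctional O).re + (A.groundStateFunctional Yv).re := by
    rw [map_add, Complex.add_re]
  have hOre : (A.groundStateFunctional O).re = 2 * (A.groundStateFunctional P).re := by
    rw [hOdef, map_add, Complex.add_re, groundStateFunctional_conjTranspose_re]; ring
  rw [hAeq, hsrc0, hsrch, hdec]
  rw [hOYre, hOre] at h1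
  have h3 : h' * (2 * (A.groundStateFunctional P).re + (A.groundStateFunctional Yv).re) ≤
      h' * (2 * (Bd * (L : ℝ) ^ 2) + ‖Yv‖) := by
    refine mul_le_mul_of_nonneg_left ?_ hh'
    rw [← hOre]
    linarith
  nlinarith [h1, h2, h3]

/-- **Diagonal transfer.** If for all small `h > 0` the `d`-wave pair density of the tracial ground
state of the doubly-sourced torus `dWaveSourceTorus (L+1) U μ h - h·Y_L` (equal strengths: the
DIAGONAL of the two-source corner) is eventually-in-`L` at least `ε`, for a Hermitian co-source family
with `‖Y_L‖ ≤ b_Y (L+1)²`, then `ε ≤ dWaveOrderParameter U μ`: against the stair `h` use the diagonal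
point `(h', h')` with `h' = o(h)` (`cw_diagonal_fin`, then `le_dWaveOrderParameter_of_le_liminf_energyGain`).
[cite: KomaTasaki1994, §1] -/
theorem cw_diagonalTransfer (U μ ε bY : ℝ)
    (Y : ∀ L : ℕ, Matrix (Finset (Orb (FermionTorus 2 (L + 1)))) (Finset (Orb (FermionTorus 2 (L + 1)))) ℂ)
    (hY : ∀ L, (Y L).IsHermitian) (hYn : ∀ L, ‖Y L‖ ≤ bY * ((L + 1 : ℕ) : ℝ) ^ 2)
    (hfloor : ∃ s₁ : ℝ, 0 < s₁ ∧ ∀ h ∈ Set.Ioo (0 : ℝ) s₁, ∀ᶠ L : ℕ in atTop,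
      ε ≤ ((dWaveSourceTorus (L + 1) U μ h - (h : ℂ) • Y L).groundStateFunctional
        (pairField dWaveFormFactor (L + 1))).re / ((L + 1 : ℕ) : ℝ) ^ 2) :
    ε ≤ dWaveOrderParameter U μ := by
  obtain ⟨s₁, hs₁, hfloor⟩ := hfloor
  set Bd : ℝ := 2 * ∑ e ∈ insert (0 : Site 2) unitSteps, |dWaveFormFactor e / Real.sqrt 2| with hBd
  have hBd0 : 0 ≤ Bd := by positivity
  have hb : 0 ≤ bY := by
    have h1 := hYn 0
    have h2 : (0 : ℝ) ≤ ‖Y 0‖ := norm_nonneg _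
    have h3 : ((0 + 1 : ℕ) : ℝ) ^ 2 = 1 := by norm_num
    rw [h3, mul_one] at h1
    linarith
  refine le_dWaveOrderParameter_of_le_liminf_energyGain U μ one_pos fun h hh => ?_
  have hhpos : 0 < h := hh.1
  apply le_of_forall_pos_le_add
  intro η hη
  -- the diagonal source strength `h' = o(h)`
  set h' : ℝ := min (s₁ / 2) (h * η / (Bd + bY + 1)) with hh'def
  have hden : 0 < Bd + bY + 1 := by linarith
  have hh'pos : 0 < h' := lt_min (by linarith) (by positivity)
  have hh'lt : h' < s₁ := (min_le_left _ _).trans_lt (by linarith)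
  have hh'le : h' ≤ h * η / (Bd + bY + 1) := min_le_right _ _
  have hcorr : h' * (Bd + bY) ≤ h * η := by
    have : h' * (Bd + bY + 1) ≤ h * η := by rwa [le_div_iff₀ hden] at hh'le
    nlinarith [hh'pos.le]
  have hF := hfloor h' ⟨hh'pos, hh'lt⟩
  -- pointwise comparison for every `L`
  have hpt : ∀ L : ℕ,
      ((dWaveSourceTorus (L + 1) U μ h' - (h' : ℂ) • Y L).groundStateFunctional
            (pairField dWaveFormFactor (L + 1))).re / ((L + 1 : ℕ) : ℝ) ^ 2 - η ≤
        ((dWaveSourceTorus (L + 1) U μ 0).groundEnergy - (dWaveSourceTorus (L + 1) U μ h).groundEnergy) /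
          (2 * h * (((L + 1 : ℕ) : ℝ)) ^ 2) := by
    intro L
    have hL : (0 : ℝ) < ((L + 1 : ℕ) : ℝ) ^ 2 := cast_sq_pos_of_neZero (L + 1)
    have key := cw_diagonal_fin (L + 1) U μ h hh'pos.le (Y L) (hY L)
    have hn := hYn L
    rw [div_sub' (hc := hL.ne'), div_le_div_iff₀ hL (by positivity)]
    set X := ((dWaveSourceTorus (L + 1) U μ h' - (h' : ℂ) • Y L).groundStateFunctional
            (pairField dWaveFormFactor (L + 1))).re with hX
    set n2 := ((L + 1 : ℕ) : ℝ) ^ 2 with hn2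
    have key' : 2 * h * X - 2 * h' * (Bd * n2 + ‖Y L‖) ≤
        (dWaveSourceTorus (L + 1) U μ 0).groundEnergy - (dWaveSourceTorus (L + 1) U μ h).groundEnergy := by
      rw [← hBd] at key
      exact key
    have hc2 : 2 * h' * (Bd * n2 + ‖Y L‖) ≤ 2 * h * η * n2 := by
      have h1 : Bd * n2 + ‖Y L‖ ≤ (Bd + bY) * n2 := by nlinarith [hn]
      have h2 : 2 * h' * (Bd * n2 + ‖Y L‖) ≤ 2 * h' * ((Bd + bY) * n2) :=
        mul_le_mul_of_nonneg_left h1 (by positivity)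
      have h3 : 2 * h' * ((Bd + bY) * n2) = 2 * (h' * (Bd + bY)) * n2 := by ring
      have h4 : 2 * (h' * (Bd + bY)) * n2 ≤ 2 * (h * η) * n2 :=
        mul_le_mul_of_nonneg_right (by linarith) hL.le
      linarith
    nlinarith [key', hc2, hL]
  -- a priori bounds for the liminf comparison
  have hup : ∀ L : ℕ,
      ((dWaveSourceTorus (L + 1) U μ 0).groundEnergy - (dWaveSourceTorus (L + 1) U μ h).groundEnergy) /
          (2 * h * (((L + 1 : ℕ) : ℝ)) ^ 2) ≤ Bd := fun L =>
    (energyGain_div_le_dWaveSourceDensity (L := L + 1) U μ hhpos).trans (dWaveSourceDensity_le_const (L + 1) U μ h)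
  have hmain : ε - η ≤ liminf (fun L : ℕ =>
      ((dWaveSourceTorus (L + 1) U μ 0).groundEnergy - (dWaveSourceTorus (L + 1) U μ h).groundEnergy) /
        (2 * h * (((L + 1 : ℕ) : ℝ)) ^ 2)) atTop := by
    refine le_liminf_of_le (isCoboundedUnder_ge_of_eventually_le atTop (Eventually.of_forall hup)) ?_
    filter_upwards [hF] with L hL
    have := hpt L
    linarith
  linarith


/-- **Registered frame stub `stub_diagonalTransfer`** (crux-plan name; `∀/→` form of `cw_diagonalTransfer`):
a floor `ε` on the `d`-wave pair density along the diagonal `(h, h)`, `h ↓ 0`, of the two-source corner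
(B₁g pair source + any norm-bounded Hermitian co-source family), eventually in `L` at each `h`, is a floor on
`dWaveOrderParameter U μ`. [cite: KomaTasaki1994, §1] -/
theorem stub_diagonalTransfer :
    ∀ (U μ ε bY : ℝ) (Y : ∀ L : ℕ, Matrix (Finset (Orb (FermionTorus 2 (L + 1)))) (Finset (Orb (FermionTorus 2 (L + 1)))) ℂ), (∀ L, (Y L).IsHermitian) → (∀ L, ‖Y L‖ ≤ bY * ((L + 1 : ℕ) : ℝ) ^ 2) → (∃ s₁ : ℝ, 0 < s₁ ∧ ∀ h ∈ Set.Ioo (0 : ℝ) s₁, ∀ᶠ L : ℕ in atTop, ε ≤ ((dWaveSourceTorus (L + 1) U μ h - (h : ℂ) • Y L).groundStateFunctional (pairField dWaveFormFactor (L + 1))).re / ((L + 1 : ℕ) : ℝ) ^ 2) → ε ≤ dWaveOrderParameter U μ :=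
  fun U μ ε bY Y hY hYn hfloor => cw_diagonalTransfer U μ ε bY Y hY hYn hfloor

end Summit.HubbardSuperconductivity.HubbardSuperconductivity.Theorems
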